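import Literature.AlgebraicGeometry.HodgeTheory.HolomorphicFormClasses
import Literature.AlgebraicGeometry.HodgeTheory.HypersurfaceHodgePQAssembly
import Literature.Geometry.Kaehler.HolomorphicFormsChart
import Literature.Analysis.Complex.OsgoodProofs
import HarnessLib

/-!
# `H^{n,0}(X^an) ≅ Ω^n(X^an)`: Voisin I, Corollary 7.6 in top degree, proved

Family `hodge`, layer `Literature/AlgebraicGeometry/HodgeTheory`. KERNEL ONLY (no records, no
definitions): the hypothesis record `HodgeModel.VoisinI_Cor_7_6 A p` of `HolomorphicFormClasses`
("`H^{p,0}(X)` is isomorphic to the space of holomorphic forms of degree `p`", C. Voisin, *Hodge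
Theory and Complex Algebraic Geometry I*, Cor. 7.6, p. 160) is PROVED in the top degree `p = n`
for every Hodge model `A` of a smooth projective `n`-fold `X` — the only instance the period /
Picard-surface chain consumes (`HodgeModel.topFormOfClass hX h76`, `n = 2`).

## Contents

* `isHolomorphicInCharts_of_isClosedForm_of_isOfType_top` — on a complex manifold with holomorphic
  atlas (`finrank ℂ E = n`), a smooth **closed** complex `n`-form of type `(n,0)` is holomorphic in
  charts (Voisin I, §2.3.3 / Huybrechts, Prop. 2.6.11, direction "`∂̄`-closed `(p,0)` ⇒ holomorphic",
  case `p = n` where `dη = ∂̄η`): the chart representative `η̂ = η.inChart x₀` is real-differentiable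
  on the chart target (`MForm.smoothAt_iff_contDiffAt_inChart`), has values of type `(n,0)`
  (`represents_typeComponent`: the coordinate changes of a holomorphic atlas are `ℂ`-linear) and
  `dη̂ = (dη)̂ = 0` (`inChart_mextDeriv_of_mem_target`); hence `η̂` is complex-differentiable
  (`differentiableOn_complex_of_typeProjAt_extDeriv_eq_zero`), so analytic (Osgood,
  `SCV.analyticAt_of_differentiableOn`), and `η̂ = η̂(e) · det_e` (`eq_smul_cdetL_of_weight`) is the
  restriction of scalars of the analytic `ℂ`-alternating map `y ↦ η̂(y)(e) · det_e`.
* `hodgePQ_top_zero_eq_range` — `H^{n,0} ⊆ H^n_dR(M; ℂ)` (the span of the classes of closed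
  `(n,0)`-forms) IS the range of the class map on `Ω^n(M)` (holomorphic in charts).
* `HodgeModel.topHolFormClass_injective` — for a Hodge model of a smooth projective variety the
  class map `Ω^n(X^an) → Hⁿ(X^an; ℂ)` is injective: a non-zero holomorphic top form is not exact
  (the tree's Kähler-free `closedForm_top_zero_not_exact`, `∫ i^{n²} η ∧ η̄ > 0` versus Stokes).
* `HodgeModel.topHolFormClassPQ_bijective`, and the discharge
  `HodgeModel.voisinI_Cor_7_6_top (A : HodgeModel n X) : A.VoisinI_Cor_7_6 n`.

References: C. Voisin, *Hodge Theory and Complex Algebraic Geometry I* (CUP 2002), §2.3.3,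
§7.1.1 Prop. 7.5, Cor. 7.6 [VoisinHodgeI2002]; D. Huybrechts, *Complex Geometry* (2005),
Prop. 2.6.11 [Huybrechts2005]; L. Hörmander, *An Introduction to Complex Analysis in Several
Variables* (1973), §2.1, Thm. 2.2.1 [HormanderSCV1973].
-/

noncomputable section

open scoped Manifold ContDiff Topology
open Set Filter Function Module
open Literature.Geometry.Kaehler Literature.NumberTheory.Transcendental Literature.Analysis.Complex

namespace Literature.AlgebraicGeometry.HodgeTheory

/-! ### Closed `(n,0)`-forms are holomorphic in charts -/

section Charts

variable {E : Type*} [NormedAddCommGroup E] [NormedSpace ℂ E] [FiniteDimensional ℂ E]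
  {M : Type*} [TopologicalSpace M] [ChartedSpace E M]
  [IsManifold 𝓘(ℂ, E) ω M] [IsManifold 𝓘(ℝ, E) ∞ M] {n : ℕ}

/-- **The chart representative of a smooth closed `(n,0)`-form is complex-differentiable on the
chart target** (`n = dim_ℂ M`): it is real-differentiable, `(n,0)`-valued, and has vanishing flat
exterior derivative, so the tree's "`∂̄`-closed `(p,0)`-forms are holomorphic" applies.
[cite: VoisinHodgeI2002, §2.3.3] [cite: HormanderSCV1973, §2.1] -/
theorem differentiableOn_complex_inChart_of_isClosedForm_of_isOfType_top
    {β : MForm 𝓘(ℝ, E) M ℂ n} (hs : IsSmoothForm β) (hc : IsClosedForm β) (ht : IsOfType n 0 β)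
    (x₀ : M) :
    DifferentiableOn ℂ (β.inChart x₀) (extChartAt 𝓘(ℝ, E) x₀).target := by
  have hs' := (isSmoothForm_iff_smoothAt β).1 hs
  have hU : IsOpen (extChartAt 𝓘(ℝ, E) x₀).target := isOpen_extChartAt_target x₀
  -- real differentiability of the representative
  have hd : DifferentiableOn ℝ (β.inChart x₀) (extChartAt 𝓘(ℝ, E) x₀).target := by
    intro y hy
    have hz : (extChartAt 𝓘(ℝ, E) x₀).symm y ∈ (extChartAt 𝓘(ℝ, E) x₀).source :=
      (extChartAt 𝓘(ℝ, E) x₀).map_target hy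
    have h := (MForm.smoothAt_iff_contDiffAt_inChart hz).1 (hs' _)
    rw [(extChartAt 𝓘(ℝ, E) x₀).right_inv hy] at h
    exact (h.differentiableAt (by simp)).differentiableWithinAt
  -- values of type `(n,0)`
  have htype : ∀ y ∈ (extChartAt 𝓘(ℝ, E) x₀).target, IsOfTypeAt n 0 (β.inChart x₀ y) := by
    intro y hy
    have h1 : (β.typeComponent n 0).inChart x₀ y = typeProjAt n 0 (β.inChart x₀ y) := by
      rw [(represents_typeComponent x₀ n 0).inChart_eq hs hy, ChartOp1.applyAt_ofCLM,
        typeProjOp_eq_typeProjAt]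
    rw [ht.typeComponent_eq_self] at h1
    exact (isOfTypeAt_iff_typeProjAt_eq_self ht.1 _).2 h1.symm
  -- the flat exterior derivative of the representative vanishes (`dβ = 0` read in the chart)
  have hcl : ∀ y ∈ (extChartAt 𝓘(ℝ, E) x₀).target, typeProjAt n 1 (extDeriv (β.inChart x₀) y) = 0 := by
    intro y hy
    have h := inChart_mextDeriv_of_mem_target β hy (hs' _)
    rw [show mextDeriv β = 0 from hc, MForm.inChart_zero, ModelWithCorners.range_eq_univ,
      extDerivWithin_univ] at h
    rw [← h]
    exact typeProjAt_zero n 1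
  exact differentiableOn_complex_of_typeProjAt_extDeriv_eq_zero hU hd htype hcl

/-- **A smooth closed form of type `(n,0)` on an `n`-dimensional complex manifold is holomorphic in
charts** (Voisin I, §2.3.3; Huybrechts, Prop. 2.6.11: a `(p,0)`-form is holomorphic iff it is
`∂̄`-closed — for `p = n`, `∂̄η = dη`). Near the centre of the chart at `x₀` the representative is
`η̂(y) = η̂(y)(e) · det_e` for a complex basis `e` (`eq_smul_cdetL_of_weight`), with `η̂` analytic
by `differentiableOn_complex_inChart_of_isClosedForm_of_isOfType_top` and Osgood's lemma.
[cite: VoisinHodgeI2002, §2.3.3] [cite: Huybrechts2005, Prop. 2.6.11] -/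
theorem isHolomorphicInCharts_of_isClosedForm_of_isOfType_top (hn : finrank ℂ E = n)
    {β : MForm 𝓘(ℝ, E) M ℂ n} (hs : IsSmoothForm β) (hc : IsClosedForm β) (ht : IsOfType n 0 β) :
    IsHolomorphicInCharts β := by
  classical
  intro x₀
  set U := (extChartAt 𝓘(ℝ, E) x₀).target with hUdef
  have hU : IsOpen U := isOpen_extChartAt_target x₀
  have hcU : extChartAt 𝓘(ℝ, E) x₀ x₀ ∈ U := mem_extChartAt_target x₀
  have hD : DifferentiableOn ℂ (β.inChart x₀) U :=
    differentiableOn_complex_inChart_of_isClosedForm_of_isOfType_top hs hc ht x₀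
  have hA : AnalyticAt ℂ (β.inChart x₀) (extChartAt 𝓘(ℝ, E) x₀ x₀) :=
    SCV.analyticAt_of_differentiableOn hD hU hcU
  -- a complex basis and the complex determinant as a `ℂ`-alternating continuous map
  let e : Basis (Fin n) ℂ E := Module.finBasisOfFinrankEq ℂ E hn
  let D : E [⋀^Fin n]→L[ℂ] ℂ :=
    { toContinuousMultilinearMap :=
        ⟨(e.det : E [⋀^Fin n]→ₗ[ℂ] ℂ).toMultilinearMap, continuous_basis_cdet e⟩
      map_eq_zero_of_eq' := fun v _ _ h hij ↦ e.det.map_eq_zero_of_eq v h hij }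
  have hD_res : D.restrictScalars ℝ = cdetL e := by
    ext v; rfl
  -- evaluation at `e` is a `ℂ`-linear continuous functional on the real-alternating forms
  let ev : (E [⋀^Fin n]→L[ℝ] ℂ) →L[ℂ] ℂ :=
    { toFun := fun a ↦ a e
      map_add' := fun _ _ ↦ rfl
      map_smul' := fun _ _ ↦ rfl
      cont := continuous_eval_const (e : Fin n → E) }
  refine ⟨fun y ↦ (β.inChart x₀ y e) • D, ?_, ?_⟩
  · have h1 : AnalyticAt ℂ (fun y ↦ β.inChart x₀ y e) (extChartAt 𝓘(ℝ, E) x₀ x₀) :=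
      (ev.analyticAt _).comp hA
    exact h1.smul analyticAt_const
  · filter_upwards [hU.mem_nhds hcU] with y hy
    -- `η̂(y)` has weight `n`, hence is `η̂(y)(e) · det_e`
    have hty : IsOfTypeAt n 0 (β.inChart x₀ y) := by
      have h1 : (β.typeComponent n 0).inChart x₀ y = typeProjAt n 0 (β.inChart x₀ y) := by
        rw [(represents_typeComponent x₀ n 0).inChart_eq hs hy, ChartOp1.applyAt_ofCLM,
          typeProjOp_eq_typeProjAt]
      rw [ht.typeComponent_eq_self] at h1
      exact (isOfTypeAt_iff_typeProjAt_eq_self ht.1 _).2 h1.symm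
    have hw : ∀ (θ : ℝ) (v : Fin n → E),
        β.inChart x₀ y (fun i ↦ Complex.exp (θ * Complex.I) • v i) =
          Complex.exp ((n : ℂ) * θ * Complex.I) * β.inChart x₀ y v := fun θ v ↦ by
      have h := hty.2 θ v
      simp only [Nat.cast_zero, sub_zero, Int.cast_natCast] at h
      exact h
    have key := eq_smul_cdetL_of_weight (β.inChart x₀ y) hw e
    rw [← hD_res] at key
    exact key.trans (by ext v; rfl)

/-- Membership form: a smooth closed `(n,0)`-form lies in `Ω^n(M)` (`holFormsInCharts`).
[cite: VoisinHodgeI2002, §2.3.3] -/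
theorem mem_holFormsInCharts_of_isClosedForm_of_isOfType_top (hn : finrank ℂ E = n)
    {β : MForm 𝓘(ℝ, E) M ℂ n} (hs : IsSmoothForm β) (hc : IsClosedForm β) (ht : IsOfType n 0 β) :
    β ∈ holFormsInCharts E M n :=
  isHolomorphicInCharts_of_isClosedForm_of_isOfType_top hn hs hc ht

/-- **`H^{n,0}` is the range of the class map on holomorphic `n`-forms**: the span of the de Rham
classes of closed `(n,0)`-forms equals the image of `Ω^n(M) → H^n_dR(M; ℂ)`, `η ↦ [η]` — every
closed `(n,0)`-form is itself holomorphic (`isHolomorphicInCharts_of_isClosedForm_of_isOfType_top`)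
and every holomorphic top form is a closed `(n,0)`-form (`IsHolomorphicInCharts.mem_cclosedSmoothForms`,
`isOfType_of_mem`). [cite: VoisinHodgeI2002, §7.1.1 Cor. 7.6] -/
theorem hodgePQ_top_zero_eq_range (hn : finrank ℂ E = n) :
    hodgePQ E M n n 0 =
      LinearMap.range (complexDeRhamCohomology.mk E M n ∘ₗ holFormsInChartsToClosed (M := M) hn) := by
  refine le_antisymm ?_ ?_
  · refine Submodule.span_le.2 ?_
    rintro _ ⟨α, hα, rfl⟩
    have hα' := (mem_cclosedSmoothForms_iff (α : MForm 𝓘(ℝ, E) M ℂ n)).1 α.2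
    refine ⟨⟨α, mem_holFormsInCharts_of_isClosedForm_of_isOfType_top hn hα'.1 hα'.2 hα⟩, ?_⟩
    simp only [LinearMap.coe_comp, Function.comp_apply]
    congr 1
  · rintro _ ⟨η, rfl⟩
    exact Submodule.subset_span ⟨holFormsInChartsToClosed hn η, isOfType_of_mem η, rfl⟩

end Charts

/-! ### Voisin I, Cor. 7.6 in top degree for Hodge models -/

namespace HodgeModel

variable {n : ℕ} {X : Motives.SchemeOver ℂ} (A : HodgeModel n X)

/-- **A non-zero holomorphic top form on `X^an` (X smooth projective) has non-zero class**: the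
class map `Ω^n(X^an) → Hⁿ(X^an; ℂ)` is injective. `X^an` is compact (`compactSpace_carrier`), so a
non-zero smooth closed `(n,0)`-form is not exact (`closedForm_top_zero_not_exact`: `∫ i^{n²} η ∧ η̄ > 0`
against Stokes; no Kähler metric needed), and the de Rham comparison is an isomorphism.
[cite: VoisinHodgeI2002, §7.1.1 Prop. 7.5 and Cor. 7.6] -/
theorem topHolFormClass_injective (hX : Motives.IsSmoothProjective n X) :
    Function.Injective A.topHolFormClass := by
  haveI : CompactSpace A.carrier := A.compactSpace_carrier hX
  refine (injective_iff_map_eq_zero _).2 fun η hη ↦ ?_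
  rw [topHolFormClass_apply, LinearEquiv.map_eq_zero_iff] at hη
  have hex : ((holFormsInChartsToClosed A.finrank_model η : cclosedSmoothForms A.model A.carrier n) :
      MForm 𝓘(ℝ, A.model) A.carrier ℂ n) ∈ cexactSmoothForms A.model A.carrier n := by
    have h := (complexDeRhamCohomology.mk_eq_mk_iff
      (holFormsInChartsToClosed A.finrank_model η) 0).1 (by rw [hη, map_zero])
    simpa using h
  rw [coe_holFormsInChartsToClosed] at hex
  by_contra h0
  have h0' : (η : MForm 𝓘(ℝ, A.model) A.carrier ℂ n) ≠ 0 := fun h ↦ h0 (Subtype.ext h)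
  exact closedForm_top_zero_not_exact n A.finrank_model (η : MForm 𝓘(ℝ, A.model) A.carrier ℂ n)
    (isSmoothForm_of_mem η) (η.2.mem_cclosedSmoothForms A.finrank_model |>
      fun h ↦ ((mem_cclosedSmoothForms_iff _).1 h).2) (isOfType_of_mem η) h0' hex

/-- The corestricted class map `Ω^n(X^an) → H^{n,0}(X^an)` is injective.
[cite: VoisinHodgeI2002, §7.1.1 Cor. 7.6] -/
theorem topHolFormClassPQ_injective (hX : Motives.IsSmoothProjective n X) :
    Function.Injective A.topHolFormClassPQ := fun η η' h ↦
  A.topHolFormClass_injective hX (by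
    have := congrArg (fun c : A.hodgePQ n n 0 ↦ (c : Literature.AlgebraicTopology.SingularHomology.singularCohomology ℂ ℂ A.carrier n)) h
    simpa using this)

/-- **The class map `Ω^n(X^an) → H^{n,0}(X^an)` is surjective** (for any Hodge model; no
projectivity needed): `H^{n,0}` is spanned by classes of closed `(n,0)`-forms, and those forms are
holomorphic (`hodgePQ_top_zero_eq_range`). [cite: VoisinHodgeI2002, §7.1.1 Cor. 7.6] -/
theorem topHolFormClassPQ_surjective : Function.Surjective A.topHolFormClassPQ := by
  rintro ⟨c, hc⟩
  obtain ⟨c', hc', rfl⟩ := Submodule.mem_map.1 hc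
  rw [hodgePQ_top_zero_eq_range A.finrank_model] at hc'
  obtain ⟨η, rfl⟩ := hc'
  exact ⟨η, Subtype.ext rfl⟩

/-- **Voisin I, Cor. 7.6 for `p = n`, proved**: for a Hodge model of a smooth projective
`n`-fold the class map `Ω^n(X^an) → H^{n,0}(X^an)` is a linear bijection.
[cite: VoisinHodgeI2002, §7.1.1 Cor. 7.6, p. 160] -/
theorem topHolFormClassPQ_bijective (hX : Motives.IsSmoothProjective n X) :
    Function.Bijective A.topHolFormClassPQ :=
  ⟨A.topHolFormClassPQ_injective hX, A.topHolFormClassPQ_surjective⟩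

/-- **Discharge of the record `HodgeModel.VoisinI_Cor_7_6` in top degree**: `A.VoisinI_Cor_7_6 n`
holds for every Hodge model `A : HodgeModel n X` (the closedness witness is `holFormsClosed_top`,
and `holFormClassPQ n _ = topHolFormClassPQ`). [cite: VoisinHodgeI2002, §7.1.1 Cor. 7.6, p. 160] -/
theorem voisinI_Cor_7_6_top : A.VoisinI_Cor_7_6 n := fun hX ↦
  ⟨A.holFormsClosed_top, by rw [holFormClassPQ_top]; exact A.topHolFormClassPQ_bijective hX⟩

end HodgeModel

end Literature.AlgebraicGeometry.HodgeTheory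

end
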